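import Summits.QuantumFields.BalabanUV.Beta.EriceRemainderEnclosureHistoryAutonomyComparisonAgeCompositionYoungPairMoment
import Summits.QuantumFields.BalabanUV.Beta.EriceRemainderEnclosureHistoryAutonomyComparisonAgeCompositionUpwardChain
import Summits.QuantumFields.BalabanUV.Beta.EriceRemainderEnclosureHistoryAutonomyComparisonAgeCompositionUpwardChainJumps

/-!
# EriceRemainderEnclosureHistoryAutonomyComparisonAgeCompositionUpwardChainSaturation — (E98d) route (N), first order, ALONG THE FLOW: THE SATURATION LETTER.
# For EVERY admissible flow, EVERY profile, EVERY damping of the self-consistent class and an age `k` read at the pin `m` (given the END beyond `m`, as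
# in every census induction): the damped read `Σ_l KL k m l·ε_{m+1+l} = c_k(m)·Σ_{j<k} G_j ε_{m+1+j}` (`G_j = Π_{t=m+1+j}^{m+k} g_t`) is at most
# **`4e_{m+1}·(1 − (1 − c_k(m)G_0∕4)^k) + c_k(m)·Σ_{j<k} (G_j − G_0)·e_{m+1+j}`** (`flow_read_saturation`): the `G_0`-part of the read SATURATES («the
# targets of the age carry their own reads», README g82 §2(c)) with a defect of second order in the load, UNIFORMLY IN `k`; the rest is the plain damped
# bound.  Mechanism ((E98a)∕(E98c)): given the END beyond `m`, the tail sums `S_p = Σ_{q≥p} ε_q` are a SUBSOLUTION of the unit-mass upward chain whose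
# jump `k′+1` from `p` has weight `c_{k′}(p)·Π_{t=p+1}^{p+k′} g_t` (`tail_subsolution`); from every position of the window `(m, m+k]` that chain leaves the
# window by its own age-`k` jump with probability `≥ c_k(m)G_0∕4` (`hazard_ge`: `h_{m+2k}² ≥ h_{m+k}²∕2` by (E90b) `mul_sq_le_from_pin`, window products
# `≥ h_{m+2k}∕h_{m+k}` by (E82a) `window_prod_ge_ratio`), so it visits the window at most `(1 − (1−η)^k)∕η` times ((E98c) `hazard_supersolution`,
# `hazard_const`), not `k` times.  §3 the SATURATED LIGHT-LOAD END (`flow_nonneg_saturated`): `Σ_k [4(1 − (1 − c_kG_0∕4)^k) + c_kΣ_j (G_j − G_0)] ≤ 1`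
# at every pin ⟹ `0 ≤ ε ≤ e`; at `g ≡ 1` this is `Σ_k 4(1 − (1 − c_k∕4)^k) ≤ 1`, weaker than (E86i)'s `Σ_k k·c_k ≤ 1` at every loaded age

Cell `pub-balaban`, β-function sub-cell, BINDER row D4 «RemainderConst leaves for Bałaban's split» (`HOME/BINDER-OWNERS.md`; owner lineage `b2b-balaban-beta-an4`;
this file by co-owner #2 lineage `b2b-balaban-beta-d4-p2`, generation 86), β-FLOW TEAM duty (1), FREEZE (0) honoured (def-free; imports (E94b) `…YoungPairMoment`,
(E98a) `…UpwardChain`, (E98c) `…UpwardChainJumps`; uses (E98a) `tail_split`∕`tail_window`, (E98c) `window_le_of_subsolution`∕`hazard_supersolution`∕`hazard_const`,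
(E94b) `load_le_of_sq`, (E91a) `old_read_eq`∕`lagZero_le`, (E90b) `mul_sq_le_from_pin`, (E82a) `window_prod_ge_ratio`∕`kernel_entry_le`, (E80b)
`aggregate_eq_sum`, (E48a) `strictAnti_of_memFlow` BY NAME; nothing restated).

HONEST FRAMING (page 1, verbatim and binding).  *"Discharging BetaPertH makes Bałaban's UV stability UNCONDITIONAL — a real constructive-QFT result; it is
NOT the continuum limit and NOT the Clay problem."*  THIS FILE DISCHARGES NOTHING OF THE KIND.  Elementary real algebra ∕ real analysis about ABSTRACT
functionals on a box ]0,γ]^ℕ with displayed floors, profiles and signs, and the FIRST-ORDER renewal objects of route (N) built from them — hypotheses of a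
census, not facts; the form, signs, ages and moments of Bałaban's (1.22) limit functional are NOT PRINTED ([I] p. 298; GAPS G-t4-U2-1∕-2) and NOT asserted.
Row D4 class UNCHANGED (critical-path width 0; instance 0∕1; D4 DISCHARGE NO DATE).  HONEST DEPENDENCY: continuum YM on T⁴ ⇐ BetaPertH ∧ nine spine
estimates (0/9 proved); BetaPertH ⇐ (D1) ∧ (D4) ∧ CAP+tail; G-an2-4 gates asym, D1 and NE2/3/4.  NOT CLAIMED: any new census profile closed (the letter
is second order in the loads, `≈ x_k²∕8` per age at `g ≡ 1`); anything nonlinear; anything printed — NOT B12 Thm 2, NOT BetaPertH, NOT continuum, NOT Clay.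

WHAT IS PROVED ([folklore]; 0 `def`, 0 sorry).  §1 `prod_window_ge_sub` (`G_j ≥ G_0`), `prod_window_persist`, **`hazard_ge`**.  §2 `read_ge_damped_window`,
**`tail_subsolution`** (the dominating unit-mass chain), **`flow_read_saturation`** (THE LETTER).  §3 **`flow_nonneg_saturated`**.
-/
noncomputable section
open Finset

namespace Summit.QuantumFields.BalabanUV.Beta.EriceRemainderEnclosureHistoryAutonomyComparisonAgeCompositionUpwardChainSaturation

open Literature.MathematicalPhysics.QuantumFieldTheory.Balaban1983to89
open Literature.MathematicalPhysics.QuantumFieldTheory.Balaban1983to89.T4BetaStationary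
open Literature.MathematicalPhysics.QuantumFieldTheory.Balaban1983to89.T4BetaFlowWellPosed
open Summit.QuantumFields.BalabanUV.Beta.EriceRemainderEnclosureHistoryAutonomyOrder (strictAnti_of_memFlow)
open Summit.QuantumFields.BalabanUV.Beta.EriceRemainderEnclosureHistoryAutonomyComparisonAgeCompositionTwoAgesOldRead (old_read_eq lagZero_le)
open Summit.QuantumFields.BalabanUV.Beta.EriceRemainderEnclosureHistoryAutonomyComparisonAgeCompositionWindowShares (mul_sq_le_from_pin)
open Summit.QuantumFields.BalabanUV.Beta.EriceRemainderEnclosureHistoryAutonomyComparisonAgeCompositionRowMass (window_prod_ge_ratio)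
open Summit.QuantumFields.BalabanUV.Beta.EriceRemainderEnclosureHistoryAutonomyComparisonAgeCompositionYoungPairMoment (load_le_of_sq)
open Summit.QuantumFields.BalabanUV.Beta.EriceRemainderEnclosureHistoryAutonomyComparisonAgeCompositionYoungestTailSumFlow (kernel_entry_le)
open Summit.QuantumFields.BalabanUV.Beta.EriceRemainderEnclosureHistoryAutonomyComparisonAgeCompositionChainWiring (aggregate_eq_sum)
open Summit.QuantumFields.BalabanUV.Beta.EriceRemainderEnclosureHistoryAutonomyComparisonAgeCompositionUpwardChain (tail_split tail_window)
open Summit.QuantumFields.BalabanUV.Beta.EriceRemainderEnclosureHistoryAutonomyComparisonAgeCompositionUpwardChainJumps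
  (window_le_of_subsolution hazard_supersolution hazard_const)

variable {B : (ℕ → ℝ) → ℝ} {γ b gIR : ℝ} {L : ℕ → ℝ} {K : ℕ} {h g : ℕ → ℝ}

/-! ## §1 Window products and the exit hazard along the flow -/

/-- Later targets of a window are damped less: `Π_{t∈[p+1+j, p+k+1)} g_t ≥ Π_{t∈[p+1, p+k+1)} g_t` for `j ≤ k`, `0 < g ≤ 1`. [folklore] -/
theorem prod_window_ge_sub (hg : ∀ t, 0 < g t ∧ g t ≤ 1) (p k j : ℕ) (hj : j ≤ k) :
    ∏ t ∈ Ico (p + 1) (p + k + 1), g t ≤ ∏ t ∈ Ico (p + 1 + j) (p + k + 1), g t := by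
  rw [← prod_Ico_consecutive _ (show p + 1 ≤ p + 1 + j by omega) (show p + 1 + j ≤ p + k + 1 by omega)]
  exact mul_le_of_le_one_left (prod_nonneg fun t _ => (hg t).1.le) (prod_le_one (fun t _ => (hg t).1.le) fun t _ => (hg t).2)

/-- **WINDOW PRODUCTS PERSIST ACROSS THE WINDOW**: for a damping of the self-consistent class, a pin `m`, an age `k ≥ 1` and a position
`m+1 ≤ p ≤ m+k`, `Π_{t∈[p+1, p+k+1)} g_t ≥ (Π_{t∈[m+1, m+k+1)} g_t)·h_{m+2k}∕h_{m+k}` ((E82a) `window_prod_ge_ratio` on `[m+k+1, m+2k+1)`). [folklore] -/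
theorem prod_window_persist (hL : ∀ k, 0 ≤ L k) (hb : 0 < b) (hlo : ∀ u, SeqBox γ u → b ≤ B u)
    (hdom : ∀ u, SeqBox γ u → ∑ k ∈ range K, L k * u k ≤ B u) (hh : SeqBox γ h) (hf : MemFlow B gIR h)
    (hg : ∀ t, 0 < g t ∧ g t ≤ 1) (hgF : ∀ t, 1 ≤ g t * (1 + ∑ k ∈ range K, L k * h (t + k) ^ 3 / 2))
    {m k p : ℕ} (hp1 : m + 1 ≤ p) (hp2 : p ≤ m + k) :
    (∏ t ∈ Ico (m + 1) (m + k + 1), g t) * (h (m + 2 * k) / h (m + k)) ≤ ∏ t ∈ Ico (p + 1) (p + k + 1), g t := by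
  have hpos : ∀ n, 0 < h n := fun n => (hh n).1
  have hP0 : ∀ a c : ℕ, 0 ≤ ∏ t ∈ Ico a c, g t := fun a c => prod_nonneg fun t _ => (hg t).1.le
  have hP1 : ∀ a c : ℕ, ∏ t ∈ Ico a c, g t ≤ 1 := fun a c => prod_le_one (fun t _ => (hg t).1.le) fun t _ => (hg t).2
  have hgF' : ∀ t, 1 / (1 + ∑ k ∈ range K, L k * h (t + k) ^ 3 / 2) ≤ g t := fun t => by
    have hF0 : 0 ≤ ∑ k ∈ range K, L k * h (t + k) ^ 3 / 2 := sum_nonneg fun k _ => by have := hL k; have := hpos (t + k); positivity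
    rw [div_le_iff₀ (by linarith)]; linarith [hgF t]
  -- the big window [m+1, m+2k+1) contains [p+1, p+k+1) and factors as the pin's window times the next one (≥ h(m+2k)/h(m+k))
  have hbig : ∏ t ∈ Ico (m + 1) (m + 2 * k + 1), g t ≤ ∏ t ∈ Ico (p + 1) (p + k + 1), g t := by
    rw [← prod_Ico_consecutive _ (show m + 1 ≤ p + 1 by omega) (show p + 1 ≤ m + 2 * k + 1 by omega),
      ← prod_Ico_consecutive _ (show p + 1 ≤ p + k + 1 by omega) (show p + k + 1 ≤ m + 2 * k + 1 by omega)]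
    calc (∏ t ∈ Ico (m + 1) (p + 1), g t) * ((∏ t ∈ Ico (p + 1) (p + k + 1), g t) * ∏ t ∈ Ico (p + k + 1) (m + 2 * k + 1), g t)
        ≤ 1 * ((∏ t ∈ Ico (p + 1) (p + k + 1), g t) * 1) :=
          mul_le_mul (hP1 _ _) (mul_le_mul_of_nonneg_left (hP1 _ _) (hP0 _ _)) (mul_nonneg (hP0 _ _) (hP0 _ _)) zero_le_one
      _ = ∏ t ∈ Ico (p + 1) (p + k + 1), g t := by ring
  have hsplit : ∏ t ∈ Ico (m + 1) (m + 2 * k + 1), g t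
      = (∏ t ∈ Ico (m + 1) (m + k + 1), g t) * ∏ t ∈ Ico (m + k + 1) (m + k + 1 + k), g t := by
    rw [show m + 2 * k + 1 = m + k + 1 + k by ring]
    exact (prod_Ico_consecutive _ (by omega) (by omega)).symm
  have hnext := window_prod_ge_ratio hL hb hlo hdom hh hf hg hgF' (m + k) k
  rw [show m + k + k = m + 2 * k by ring] at hnext
  calc (∏ t ∈ Ico (m + 1) (m + k + 1), g t) * (h (m + 2 * k) / h (m + k))
      ≤ (∏ t ∈ Ico (m + 1) (m + k + 1), g t) * ∏ t ∈ Ico (m + k + 1) (m + k + 1 + k), g t := mul_le_mul_of_nonneg_left hnext (hP0 _ _)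
    _ = ∏ t ∈ Ico (m + 1) (m + 2 * k + 1), g t := hsplit.symm
    _ ≤ _ := hbig

/-- **THE EXIT HAZARD OF AN AGE PERSISTS ACROSS ITS WINDOW.**  Along every flow, for the self-consistent damping class, an age `k ≥ 1` at the pin `m` and
a position `m+1 ≤ p ≤ m+k`: `c_k(p)·Π_{t∈[p+1, p+k+1)} g_t ≥ c_k(m)·G_0∕4`, `G_0 = Π_{t∈[m+1, m+k+1)} g_t`, `c_k(n) = L_kh_{n+k}³∕2` — since `h_{p+k} ≥ h_{m+2k}`,
`h_{m+2k}² ≥ h_{m+k}²∕2` ((E90b) `mul_sq_le_from_pin`) and `prod_window_persist`: `(h_{m+2k}∕h_{m+k})⁴ ≥ 1∕4`. [folklore] -/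
theorem hazard_ge (hmono : ∀ u v : ℕ → ℝ, SeqBox γ u → SeqBox γ v → (∀ j, u j ≤ v j) → B u ≤ B v)
    (hL : ∀ k, 0 ≤ L k) (hb : 0 < b) (hlo : ∀ u, SeqBox γ u → b ≤ B u) (hdom : ∀ u, SeqBox γ u → ∑ k ∈ range K, L k * u k ≤ B u)
    (hh : SeqBox γ h) (hf : MemFlow B gIR h) (hg : ∀ t, 0 < g t ∧ g t ≤ 1) (hgF : ∀ t, 1 ≤ g t * (1 + ∑ k ∈ range K, L k * h (t + k) ^ 3 / 2))
    {m k p : ℕ} (hk : 1 ≤ k) (hp1 : m + 1 ≤ p) (hp2 : p ≤ m + k) :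
    (L k * h (m + k) ^ 3 / 2) * (∏ t ∈ Ico (m + 1) (m + k + 1), g t) / 4
      ≤ (L k * h (p + k) ^ 3 / 2) * ∏ t ∈ Ico (p + 1) (p + k + 1), g t := by
  have hpos : ∀ n, 0 < h n := fun n => (hh n).1
  have hP0 : 0 ≤ ∏ t ∈ Ico (m + 1) (m + k + 1), g t := prod_nonneg fun t _ => (hg t).1.le
  set G0 := ∏ t ∈ Ico (m + 1) (m + k + 1), g t with hG0
  have h1 := hpos (m + k); have h2 := hpos (m + 2 * k); have h3 := hpos (p + k)
  -- levels: h(m+k)² ≤ 2 h(m+2k)²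
  have hsq : h (m + k) ^ 2 ≤ 2 * h (m + 2 * k) ^ 2 := by
    have := mul_sq_le_from_pin hmono hb hlo hh hf m k k
    rw [show m + k + k = m + 2 * k by ring] at this
    have hkr : (1 : ℝ) ≤ k := by exact_mod_cast hk
    nlinarith [sq_nonneg (h (m + 2 * k)), sq_nonneg (h (m + k))]
  -- hence h(m+k)³ ≤ 4 h(m+2k)⁴ / h(m+k), i.e. h(m+k)⁴ ≤ 4 h(m+2k)⁴
  have h4 : h (m + k) ^ 4 ≤ 4 * h (m + 2 * k) ^ 4 := by nlinarith [hsq, sq_nonneg (h (m + k)), sq_nonneg (h (m + 2 * k))]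
  have hprod := prod_window_persist hL hb hlo hdom hh hf hg hgF (k := k) hp1 hp2
  rw [← hG0] at hprod
  have hLk := hL k
  have hc3 : h (m + 2 * k) ^ 3 ≤ h (p + k) ^ 3 :=
    pow_le_pow_left₀ h2.le ((strictAnti_of_memFlow hb hlo hh hf).antitone (by omega : p + k ≤ m + 2 * k)) 3
  calc L k * h (m + k) ^ 3 / 2 * G0 / 4 = (L k / 2) * G0 * (h (m + k) ^ 4 / 4) / h (m + k) := by field_simp
    _ ≤ (L k / 2) * G0 * h (m + 2 * k) ^ 4 / h (m + k) := by
        refine div_le_div_of_nonneg_right (mul_le_mul_of_nonneg_left (by linarith) (by positivity)) h1.le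
    _ = (L k / 2) * h (m + 2 * k) ^ 3 * (G0 * (h (m + 2 * k) / h (m + k))) := by field_simp
    _ ≤ (L k / 2) * h (p + k) ^ 3 * ∏ t ∈ Ico (p + 1) (p + k + 1), g t :=
        mul_le_mul (mul_le_mul_of_nonneg_left hc3 (by positivity)) hprod (by positivity) (by positivity)
    _ = L k * h (p + k) ^ 3 / 2 * ∏ t ∈ Ico (p + 1) (p + k + 1), g t := by ring

/-! ## §2 The dominating chain and the saturation letter -/

/-- The damped read of an age dominates its least-damped part: with `ε ≥ 0` beyond the pin `p`,
`Σ_l KL k p l·ε_{p+1+l} ≥ c_k(p)·(Π_{t∈[p+1,p+k+1)} g_t)·Σ_{j<k} ε_{p+1+j}`. [folklore] -/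
theorem read_ge_damped_window (hL : ∀ k, 0 ≤ L k) (hh : SeqBox γ h) (hg : ∀ t, 0 < g t ∧ g t ≤ 1) {KL : ℕ → ℕ → ℕ → ℝ}
    (hKL : ∀ k n l, KL k n l = if 0 < k ∧ k < K ∧ l < k then L k * h (n + k) ^ 3 / 2 * ∏ t ∈ Ico (n + 1 + l) (n + k + 1), g t else 0)
    {k : ℕ} (hk : 0 < k) (hkK : k < K) (p : ℕ) {ε : ℕ → ℝ} (hnn : ∀ q, p < q → 0 ≤ ε q) :
    (L k * h (p + k) ^ 3 / 2) * (∏ t ∈ Ico (p + 1) (p + k + 1), g t) * ∑ j ∈ range k, ε (p + 1 + j)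
      ≤ ∑ l ∈ range K, KL k p l * ε (p + 1 + l) := by
  rw [old_read_eq hKL hk hkK p ε, mul_sum]
  refine sum_le_sum fun j hj => ?_
  have hc : 0 ≤ L k * h (p + k) ^ 3 / 2 := by have := hL k; have := (hh (p + k)).1; positivity
  have := prod_window_ge_sub hg p k j (mem_range.mp hj).le
  have hε := hnn (p + 1 + j) (by omega)
  calc L k * h (p + k) ^ 3 / 2 * (∏ t ∈ Ico (p + 1) (p + k + 1), g t) * ε (p + 1 + j)
      ≤ L k * h (p + k) ^ 3 / 2 * (∏ t ∈ Ico (p + 1 + j) (p + k + 1), g t) * ε (p + 1 + j) :=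
        mul_le_mul_of_nonneg_right (mul_le_mul_of_nonneg_left this hc) hε
    _ = _ := by ring

/-- **THE DOMINATING CHAIN.**  Along every flow (`L ≥ 0`, `L_0 = 0`), any damping `0 < g ≤ 1`, the first-order objects of route (N): at a pin `p` beyond
which `ε ≥ 0`, the tail sums `S_q = Σ_{q′=q}^{N} ε_{q′}` satisfy `S_p ≤ e_p + Σ_{i<K} P_p(i)·S_{p+1+i}` with the UNIT-MASS jump weights
`P_p(0) = 1 − Σ_{1≤k<K} c_k(p)Π_{t∈[p+1,p+k+1)} g_t ≥ 0`, `P_p(k) = c_k(p)Π_{t∈[p+1,p+k+1)} g_t` (`1 ≤ k < K`). [folklore] -/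
theorem tail_subsolution (hmono : ∀ u v : ℕ → ℝ, SeqBox γ u → SeqBox γ v → (∀ j, u j ≤ v j) → B u ≤ B v)
    (hL : ∀ k, 0 ≤ L k) (hb : 0 < b) (hlo : ∀ u, SeqBox γ u → b ≤ B u) (hdom : ∀ u, SeqBox γ u → ∑ k ∈ range K, L k * u k ≤ B u)
    (hh : SeqBox γ h) (hf : MemFlow B gIR h) (hL0 : L 0 = 0) (hg : ∀ t, 0 < g t ∧ g t ≤ 1) (hK : 1 ≤ K)
    {N : ℕ} {KL : ℕ → ℕ → ℕ → ℝ}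
    (hKL : ∀ k n l, KL k n l = if 0 < k ∧ k < K ∧ l < k then L k * h (n + k) ^ 3 / 2 * ∏ t ∈ Ico (n + 1 + l) (n + k + 1), g t else 0)
    {KA : ℕ → ℕ → ℕ → ℝ} {RA : ℕ → (ℕ → ℝ) → ℕ → ℝ}
    (hRA : ∀ i v m, RA i v m = ∑ l ∈ range K, KA i m l * v (m + 1 + l))
    (hKA : ∀ i m l, KA i m l = KL i m l + KA (i + 1) m l) (hKAtop : ∀ m l, KA K m l = 0)
    {e ε : ℕ → ℝ} (hεt : ∀ m, N < m → ε m = 0) (hεrec : ∀ m, ε m = e m - RA 1 ε m)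
    {S : ℕ → ℝ} (hS : ∀ m, S m = ∑ q ∈ Ico m (N + 1), ε q)
    {P : ℕ → ℕ → ℝ} (hP : ∀ p i, P p i = if i = 0 then 1 - ∑ k ∈ Ico 1 K, (L k * h (p + k) ^ 3 / 2) * ∏ t ∈ Ico (p + 1) (p + k + 1), g t
      else (L i * h (p + i) ^ 3 / 2) * ∏ t ∈ Ico (p + 1) (p + i + 1), g t) :
    (∀ p i, 0 ≤ P p i) ∧ (∀ p, ∑ i ∈ range K, P p i ≤ 1) ∧
      (∀ p, (∀ q, p < q → 0 ≤ ε q) → S p ≤ e p + ∑ i ∈ range K, P p i * S (p + 1 + i)) := by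
  have hpos : ∀ n, 0 < h n := fun n => (hh n).1
  have hc0 : ∀ k n, 0 ≤ L k * h (n + k) ^ 3 / 2 := fun k n => by have := hL k; have := hpos (n + k); positivity
  have hP0 : ∀ a c : ℕ, 0 ≤ ∏ t ∈ Ico a c, g t := fun a c => prod_nonneg fun t _ => (hg t).1.le
  have hP1 : ∀ a c : ℕ, ∏ t ∈ Ico a c, g t ≤ 1 := fun a c => prod_le_one (fun t _ => (hg t).1.le) fun t _ => (hg t).2
  obtain ⟨n, rfl⟩ : ∃ n, K = n + 1 := ⟨K - 1, by omega⟩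
  -- the long-jump weights are below the row weight F_p ≤ 1/(p+1) ≤ 1
  have hjump : ∀ p, ∑ k ∈ Ico 1 (n + 1), (L k * h (p + k) ^ 3 / 2) * ∏ t ∈ Ico (p + 1) (p + k + 1), g t ≤ 1 := by
    intro p
    have hF := lagZero_le hmono hL hb hlo hdom hh hf hL0 p
    have hp1 : 1 / ((p : ℝ) + 1) ≤ 1 := by
      rw [div_le_one (by positivity)]; have : (0 : ℝ) ≤ p := Nat.cast_nonneg p; linarith
    calc ∑ k ∈ Ico 1 (n + 1), (L k * h (p + k) ^ 3 / 2) * ∏ t ∈ Ico (p + 1) (p + k + 1), g t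
        ≤ ∑ k ∈ Ico 1 (n + 1), L k * h (p + k) ^ 3 / 2 := sum_le_sum fun k _ => mul_le_of_le_one_right (hc0 k p) (hP1 _ _)
      _ ≤ ∑ k ∈ range (n + 1), L k * h (p + k) ^ 3 / 2 :=
          sum_le_sum_of_subset_of_nonneg (fun k hk => mem_range.mpr (mem_Ico.mp hk).2) fun k _ _ => hc0 k p
      _ ≤ 1 := hF.trans hp1
  have hsumP : ∀ p, ∑ i ∈ range (n + 1), P p i
      = P p 0 + ∑ k ∈ Ico 1 (n + 1), (L k * h (p + k) ^ 3 / 2) * ∏ t ∈ Ico (p + 1) (p + k + 1), g t := by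
    intro p
    rw [range_eq_Ico, sum_eq_sum_Ico_succ_bot (by omega)]
    congr 1
    exact sum_congr rfl fun k hk => by rw [hP, if_neg (by have := (mem_Ico.mp hk).1; omega)]
  refine ⟨fun p i => ?_, fun p => ?_, fun p hnn => ?_⟩
  · rw [hP]
    split_ifs with hi
    · linarith [hjump p]
    · exact mul_nonneg (hc0 i p) (hP0 _ _)
  · rw [hsumP, hP, if_pos rfl]; linarith
  · -- the reads dominate their least-damped parts
    have hsplit := tail_split hεt hS
    have hreads : RA 1 ε p = ∑ k ∈ Ico 1 (n + 1), ∑ l ∈ range (n + 1), KL k p l * ε (p + 1 + l) := by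
      rw [hRA]
      simp_rw [aggregate_eq_sum hKA hKAtop (show 1 ≤ n + 1 by omega), sum_mul]
      rw [sum_comm]
    have hge : ∀ k ∈ Ico 1 (n + 1), (L k * h (p + k) ^ 3 / 2) * (∏ t ∈ Ico (p + 1) (p + k + 1), g t) * (S (p + 1) - S (p + 1 + k))
        ≤ ∑ l ∈ range (n + 1), KL k p l * ε (p + 1 + l) := by
      intro k hk
      have hk' := mem_Ico.mp hk
      rw [← tail_window hεt hS (p + 1) k]
      exact read_ge_damped_window hL hh hg hKL (by omega) hk'.2 p hnn
    have hsum := sum_le_sum hge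
    rw [← hreads] at hsum
    -- S p = e p + S (p+1) − RA 1 ε p
    have hSp : S p = e p + S (p + 1) - RA 1 ε p := by rw [hsplit p, hεrec p]; ring
    rw [hSp]
    have e2 : ∑ k ∈ Ico 1 (n + 1), P p k * S (p + 1 + k)
        = ∑ k ∈ Ico 1 (n + 1), (L k * h (p + k) ^ 3 / 2) * (∏ t ∈ Ico (p + 1) (p + k + 1), g t) * S (p + 1 + k) :=
      sum_congr rfl fun k hk => by rw [hP, if_neg (by have := (mem_Ico.mp hk).1; omega)]
    have e3 : ∑ i ∈ range (n + 1), P p i * S (p + 1 + i) = P p 0 * S (p + 1 + 0) + ∑ k ∈ Ico 1 (n + 1), P p k * S (p + 1 + k) := by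
      rw [range_eq_Ico, sum_eq_sum_Ico_succ_bot (by omega)]
    rw [e3, e2, hP, if_pos rfl, add_zero]
    have e4 : ∑ k ∈ Ico 1 (n + 1), (L k * h (p + k) ^ 3 / 2) * (∏ t ∈ Ico (p + 1) (p + k + 1), g t) * (S (p + 1) - S (p + 1 + k))
        = (∑ k ∈ Ico 1 (n + 1), (L k * h (p + k) ^ 3 / 2) * ∏ t ∈ Ico (p + 1) (p + k + 1), g t) * S (p + 1)
          - ∑ k ∈ Ico 1 (n + 1), (L k * h (p + k) ^ 3 / 2) * (∏ t ∈ Ico (p + 1) (p + k + 1), g t) * S (p + 1 + k) := by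
      rw [sum_mul, ← sum_sub_distrib]; exact sum_congr rfl fun k _ => by ring
    rw [e4] at hsum
    linarith

/-- **THE SATURATION LETTER.**  `B` isotone on the box with floor `b > 0` dominating the profile `L ≥ 0` (`L_0 = 0`), `h` a box solution, a damping of
the self-consistent class (`0 < g ≤ 1`, `g_t(1+F_t) ≥ 1`), the first-order objects of route (N), `e ≥ 0` non-increasing, an age `1 ≤ k < K`, a pin `m`
beyond which the END holds (`0 ≤ ε_q ≤ e_q` for `q > m`).  With `c = L_kh_{m+k}³∕2` and `G_j = Π_{t∈[m+1+j, m+k+1)} g_t`: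
`Σ_l KL k m l·ε_{m+1+l} ≤ 4e_{m+1}·(1 − (1 − c·G_0∕4)^k) + c·Σ_{j<k} (G_j − G_0)·e_{m+1+j}` — the targets of the age carry their own reads. [folklore] -/
theorem flow_read_saturation (hmono : ∀ u v : ℕ → ℝ, SeqBox γ u → SeqBox γ v → (∀ j, u j ≤ v j) → B u ≤ B v)
    (hL : ∀ k, 0 ≤ L k) (hb : 0 < b) (hlo : ∀ u, SeqBox γ u → b ≤ B u) (hdom : ∀ u, SeqBox γ u → ∑ k ∈ range K, L k * u k ≤ B u)
    (hh : SeqBox γ h) (hf : MemFlow B gIR h) (hL0 : L 0 = 0) (hg : ∀ t, 0 < g t ∧ g t ≤ 1)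
    (hgF : ∀ t, 1 ≤ g t * (1 + ∑ k ∈ range K, L k * h (t + k) ^ 3 / 2))
    {N : ℕ} {KL : ℕ → ℕ → ℕ → ℝ}
    (hKL : ∀ k n l, KL k n l = if 0 < k ∧ k < K ∧ l < k then L k * h (n + k) ^ 3 / 2 * ∏ t ∈ Ico (n + 1 + l) (n + k + 1), g t else 0)
    {KA : ℕ → ℕ → ℕ → ℝ} {RA : ℕ → (ℕ → ℝ) → ℕ → ℝ}
    (hRA : ∀ i v m, RA i v m = ∑ l ∈ range K, KA i m l * v (m + 1 + l))
    (hKA : ∀ i m l, KA i m l = KL i m l + KA (i + 1) m l) (hKAtop : ∀ m l, KA K m l = 0)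
    {e ε : ℕ → ℝ} (he0 : ∀ m, 0 ≤ e m) (hea : ∀ m, e (m + 1) ≤ e m)
    (hεt : ∀ m, N < m → ε m = 0) (hεrec : ∀ m, ε m = e m - RA 1 ε m)
    {k : ℕ} (hk : 1 ≤ k) (hkK : k < K) {m : ℕ} (IH : ∀ q, m < q → 0 ≤ ε q ∧ ε q ≤ e q) :
    ∑ l ∈ range K, KL k m l * ε (m + 1 + l)
      ≤ 4 * e (m + 1) * (1 - (1 - (L k * h (m + k) ^ 3 / 2) * (∏ t ∈ Ico (m + 1) (m + k + 1), g t) / 4) ^ k)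
        + (L k * h (m + k) ^ 3 / 2) * ∑ j ∈ range k, ((∏ t ∈ Ico (m + 1 + j) (m + k + 1), g t) - ∏ t ∈ Ico (m + 1) (m + k + 1), g t) * e (m + 1 + j) := by
  have hpos : ∀ n, 0 < h n := fun n => (hh n).1
  have hanti : Antitone e := antitone_nat_of_succ_le hea
  have hK : 1 ≤ K := by omega
  set c : ℝ := L k * h (m + k) ^ 3 / 2 with hc
  set G0 : ℝ := ∏ t ∈ Ico (m + 1) (m + k + 1), g t with hG0
  have hc0 : 0 ≤ c := by have := hL k; have := hpos (m + k); positivity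
  have hG00 : 0 ≤ G0 := prod_nonneg fun t _ => (hg t).1.le
  have hG01 : G0 ≤ 1 := prod_le_one (fun t _ => (hg t).1.le) fun t _ => (hg t).2
  -- the load of the age is at most 1 ((E94b) with so = 1)
  have hk1 : (1 : ℝ) ≤ k := by exact_mod_cast hk
  have hx : (k : ℝ) * c ≤ 1 := load_le_of_sq hmono hL hb hlo hdom hh hf hk hkK one_pos (by nlinarith) m
  -- split the read: G_0·(window sum) + Σ (G_j − G_0) ε_j ≤ G_0·W + Σ (G_j − G_0) e_j
  have hread : ∑ l ∈ range K, KL k m l * ε (m + 1 + l)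
      = c * G0 * ∑ j ∈ range k, ε (m + 1 + j)
        + c * ∑ j ∈ range k, ((∏ t ∈ Ico (m + 1 + j) (m + k + 1), g t) - G0) * ε (m + 1 + j) := by
    rw [old_read_eq hKL (by omega) hkK m ε, mul_sum, mul_sum, ← sum_add_distrib]
    exact sum_congr rfl fun j _ => by rw [← hc]; ring
  have hrest : c * ∑ j ∈ range k, ((∏ t ∈ Ico (m + 1 + j) (m + k + 1), g t) - G0) * ε (m + 1 + j)
      ≤ c * ∑ j ∈ range k, ((∏ t ∈ Ico (m + 1 + j) (m + k + 1), g t) - G0) * e (m + 1 + j) := by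
    refine mul_le_mul_of_nonneg_left (sum_le_sum fun j hj => ?_) hc0
    exact mul_le_mul_of_nonneg_left (IH _ (by omega)).2 (sub_nonneg.mpr (prod_window_ge_sub hg m k j (mem_range.mp hj).le))
  -- the window sum against the hazard supersolution of the dominating chain
  obtain ⟨S, hS⟩ : ∃ S : ℕ → ℝ, ∀ n, S n = ∑ q ∈ Ico n (N + 1), ε q := ⟨_, fun _ => rfl⟩
  obtain ⟨P, hP⟩ : ∃ P : ℕ → ℕ → ℝ, ∀ p i, P p i = if i = 0 then 1 - ∑ k ∈ Ico 1 K, (L k * h (p + k) ^ 3 / 2) * ∏ t ∈ Ico (p + 1) (p + k + 1), g t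
      else (L i * h (p + i) ^ 3 / 2) * ∏ t ∈ Ico (p + 1) (p + i + 1), g t := ⟨_, fun _ _ => rfl⟩
  obtain ⟨hP0, hPmass, hsub⟩ := tail_subsolution hmono hL hb hlo hdom hh hf hL0 hg hK hKL hRA hKA hKAtop hεt hεrec hS hP
  set η : ℝ := c * G0 / 4 with hη
  have hη0 : 0 ≤ η := by positivity
  obtain ⟨ψ, hψ⟩ : ∃ ψ : ℕ → ℝ, ∀ q, ψ q = ∑ j ∈ range (m + 1 + k - q), (1 - η) ^ j := ⟨_, fun _ => rfl⟩
  have hψoff : ∀ q, m + 1 + k ≤ q → ψ q = 0 := fun q hq => by rw [hψ, Nat.sub_eq_zero_of_le hq, sum_range_zero]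
  have hψrec : ∀ q, m + 1 ≤ q → q < m + 1 + k → ψ q = 1 + (1 - η) * ψ (q + 1) := by
    intro q _ hq
    rw [hψ, hψ, show m + 1 + k - q = m + 1 + k - (q + 1) + 1 by omega, sum_range_succ', pow_zero, mul_sum, add_comm]
    congr 1
    exact sum_congr rfl fun j _ => by ring
  -- the exit hazard: the age-k jump (index i = k) always leaves the window
  have hexit : ∀ q, m + 1 ≤ q → q + 2 ≤ m + 1 + k → η ≤ ∑ i ∈ range K, (if m + 1 + k ≤ q + 1 + i then P q i else 0) := by
    intro q hq1 hq2
    calc η ≤ (L k * h (q + k) ^ 3 / 2) * ∏ t ∈ Ico (q + 1) (q + k + 1), g t := by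
          rw [hη, hc, hG0]; exact hazard_ge hmono hL hb hlo hdom hh hf hg hgF hk hq1 (by omega : q ≤ m + k)
      _ = (if m + 1 + k ≤ q + 1 + k then P q k else 0) := by rw [if_pos (by omega), hP, if_neg (by omega)]
      _ ≤ ∑ i ∈ range K, (if m + 1 + k ≤ q + 1 + i then P q i else 0) := by
          refine single_le_sum (f := fun i => if m + 1 + k ≤ q + 1 + i then P q i else 0) (fun i _ => ?_) (mem_range.mpr hkK)
          split_ifs; exacts [hP0 q i, le_rfl]
  have hrem : ∀ q, m + 1 ≤ q → q < m + 1 + k → η * (((m + 1 + k : ℕ) : ℝ) - q - 1) ≤ 1 := by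
    intro q hq1 _
    have hr : ((m + 1 + k : ℕ) : ℝ) - q - 1 ≤ k := by
      have : ((m + 1 : ℕ) : ℝ) ≤ q := by exact_mod_cast hq1
      push_cast at this ⊢; linarith
    have hkc : (k : ℝ) * c * G0 ≤ 1 * 1 := mul_le_mul hx hG01 hG00 zero_le_one
    calc η * (((m + 1 + k : ℕ) : ℝ) - q - 1) ≤ η * k := mul_le_mul_of_nonneg_left hr hη0
      _ = (k : ℝ) * c * G0 / 4 := by rw [hη]; ring
      _ ≤ 1 := by linarith
  obtain ⟨-, -, hψsuper⟩ := hazard_supersolution (Jw := K) (s := m + 1) (k := k) (P := P) (η := fun _ => η) (ψ := ψ)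
    hP0 hPmass (fun _ => hη0) hexit hrem hψoff hψrec
  -- S is non-negative and non-increasing beyond m
  have hSfar : ∀ q, m < q → 0 ≤ S q ∧ S (q + 1) ≤ S q := by
    intro q hq
    refine ⟨by rw [hS]; exact sum_nonneg fun i hi => (IH i (by have := (mem_Ico.mp hi).1; omega)).1, ?_⟩
    have := tail_split hεt hS q
    linarith [(IH q hq).1]
  have hSmono : ∀ p q, m < q → q ≤ p → S p ≤ S q := by
    intro p q hq hqp
    obtain ⟨d, rfl⟩ : ∃ d, p = q + d := ⟨p - q, by omega⟩
    clear hqp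
    induction d with
    | zero => simp
    | succ d ih =>
      have h2 : S (q + (d + 1)) ≤ S (q + d) := by rw [← add_assoc]; exact (hSfar (q + d) (by omega)).2
      exact h2.trans ih
  have hW : S (m + 1) ≤ e (m + 1) * ψ (m + 1) + S (m + 1 + k) :=
    window_le_of_subsolution (Jw := K) (s := m + 1) (k := k) hP0 hPmass (he0 _)
      (fun q hq1 hq2 => (hsub q fun q' hq' => (IH q' (by omega)).1).trans (by linarith [hanti (show m + 1 ≤ q from hq1)]))
      (fun q hq => (hSfar q (by omega)).1) (fun q hq => hSmono q (m + 1 + k) (by omega) hq) hψoff hψsuper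
  have hWsum : ∑ j ∈ range k, ε (m + 1 + j) ≤ e (m + 1) * ψ (m + 1) := by
    rw [tail_window hεt hS (m + 1) k]; linarith
  -- the constant hazard closed form: η ψ(m+1) = 1 − (1−η)^k
  have hconst := hazard_const (s := m + 1) (k := k) (η := fun _ => η) hψoff hψrec (fun _ _ _ => rfl) (m + 1) le_rfl (by omega)
  rw [show m + 1 + k - (m + 1) = k by omega] at hconst
  -- assemble: c G0 W ≤ c G0 e ψ = 4 e (η ψ) = 4 e (1 − (1−η)^k)
  have hfirst : c * G0 * ∑ j ∈ range k, ε (m + 1 + j) ≤ 4 * e (m + 1) * (1 - (1 - η) ^ k) := by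
    calc c * G0 * ∑ j ∈ range k, ε (m + 1 + j) ≤ c * G0 * (e (m + 1) * ψ (m + 1)) :=
          mul_le_mul_of_nonneg_left hWsum (by positivity)
      _ = 4 * e (m + 1) * (η * ψ (m + 1)) := by rw [hη]; ring
      _ = 4 * e (m + 1) * (1 - (1 - η) ^ k) := by rw [hconst]
  rw [hread]
  rw [show (1 - c * G0 / 4) = 1 - η by rw [hη]]
  linarith [hfirst, hrest]

/-! ## §3 The saturated light-load END -/

/-- **THE SATURATED LIGHT-LOAD END.**  `B` isotone with floor `b > 0` dominating `L ≥ 0` (`L_0 = 0`), `h` a box solution, a damping of the self-consistent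
class, the first-order objects of route (N), `e ≥ 0` non-increasing, any horizon.  If at every pin `m`
`Σ_{1≤k<K} [4(1 − (1 − c_k(m)G_0^{(m,k)}∕4)^k) + c_k(m)·Σ_{j<k} (G_j^{(m,k)} − G_0^{(m,k)})] ≤ 1` (`c_k(m) = L_kh_{m+k}³∕2`,
`G_j^{(m,k)} = Π_{t∈[m+1+j,m+k+1)} g_t`), then `0 ≤ ε ≤ e` at every pin (at `g ≡ 1`: `Σ_k 4(1 − (1 − c_k(m)∕4)^k) ≤ 1` ⟸ `Σ_k k·c_k(m) ≤ 1`). [folklore] -/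
theorem flow_nonneg_saturated (hmono : ∀ u v : ℕ → ℝ, SeqBox γ u → SeqBox γ v → (∀ j, u j ≤ v j) → B u ≤ B v)
    (hL : ∀ k, 0 ≤ L k) (hb : 0 < b) (hlo : ∀ u, SeqBox γ u → b ≤ B u) (hdom : ∀ u, SeqBox γ u → ∑ k ∈ range K, L k * u k ≤ B u)
    (hh : SeqBox γ h) (hf : MemFlow B gIR h) (hL0 : L 0 = 0) (hg : ∀ t, 0 < g t ∧ g t ≤ 1)
    (hgF : ∀ t, 1 ≤ g t * (1 + ∑ k ∈ range K, L k * h (t + k) ^ 3 / 2))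
    {N : ℕ} {KL : ℕ → ℕ → ℕ → ℝ}
    (hKL : ∀ k n l, KL k n l = if 0 < k ∧ k < K ∧ l < k then L k * h (n + k) ^ 3 / 2 * ∏ t ∈ Ico (n + 1 + l) (n + k + 1), g t else 0)
    {KA : ℕ → ℕ → ℕ → ℝ} {RA : ℕ → (ℕ → ℝ) → ℕ → ℝ}
    (hRA : ∀ i v m, RA i v m = ∑ l ∈ range K, KA i m l * v (m + 1 + l))
    (hKA : ∀ i m l, KA i m l = KL i m l + KA (i + 1) m l) (hKAtop : ∀ m l, KA K m l = 0)
    {e ε : ℕ → ℝ} (he0 : ∀ m, 0 ≤ e m) (hea : ∀ m, e (m + 1) ≤ e m)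
    (hεt : ∀ m, N < m → ε m = 0) (hεrec : ∀ m, ε m = e m - RA 1 ε m)
    (hcrit : ∀ m, ∑ k ∈ Ico 1 K, (4 * (1 - (1 - (L k * h (m + k) ^ 3 / 2) * (∏ t ∈ Ico (m + 1) (m + k + 1), g t) / 4) ^ k)
        + (L k * h (m + k) ^ 3 / 2) * ∑ j ∈ range k, ((∏ t ∈ Ico (m + 1 + j) (m + k + 1), g t) - ∏ t ∈ Ico (m + 1) (m + k + 1), g t)) ≤ 1) :
    ∀ m, 0 ≤ ε m ∧ ε m ≤ e m := by
  have hpos : ∀ n, 0 < h n := fun n => (hh n).1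
  have hanti : Antitone e := antitone_nat_of_succ_le hea
  suffices step : ∀ m, (∀ q, m < q → 0 ≤ ε q ∧ ε q ≤ e q) → 0 ≤ ε m ∧ ε m ≤ e m by
    have main : ∀ n m, N < m + n → 0 ≤ ε m ∧ ε m ≤ e m := by
      intro n
      induction n with
      | zero => intro m hm; rw [hεt m (by omega)]; exact ⟨le_rfl, he0 m⟩
      | succ n ih => intro m hm; exact step m fun q hq => ih q (by omega)
    exact fun m => main (N + 1) m (by omega)
  intro m IH
  rcases Nat.eq_zero_or_pos K with hK0 | hK
  · -- no ages: the read vanishes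
    have : RA 1 ε m = 0 := by rw [hRA, hK0]; simp
    rw [hεrec m, this, sub_zero]; exact ⟨he0 m, le_rfl⟩
  obtain ⟨n, rfl⟩ : ∃ n, K = n + 1 := ⟨K - 1, by omega⟩
  have hreads : RA 1 ε m = ∑ k ∈ Ico 1 (n + 1), ∑ l ∈ range (n + 1), KL k m l * ε (m + 1 + l) := by
    rw [hRA]; simp_rw [aggregate_eq_sum hKA hKAtop (show 1 ≤ n + 1 by omega), sum_mul]; rw [sum_comm]
  have hRnn : 0 ≤ RA 1 ε m := by
    rw [hRA]
    refine sum_nonneg fun l _ => mul_nonneg ?_ (IH _ (by omega)).1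
    rw [aggregate_eq_sum hKA hKAtop (show 1 ≤ n + 1 by omega)]
    exact sum_nonneg fun k _ => (kernel_entry_le hL hh hg hKL k m l).1
  refine ⟨?_, by rw [hεrec m]; linarith⟩
  -- each age's read against the saturation letter, the remainders with e_{m+1+j} ≤ e_{m+1}
  have hle : RA 1 ε m ≤ e (m + 1) := by
    have hk_le : ∀ k ∈ Ico 1 (n + 1), ∑ l ∈ range (n + 1), KL k m l * ε (m + 1 + l)
        ≤ e (m + 1) * ((4 * (1 - (1 - (L k * h (m + k) ^ 3 / 2) * (∏ t ∈ Ico (m + 1) (m + k + 1), g t) / 4) ^ k))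
            + (L k * h (m + k) ^ 3 / 2) * ∑ j ∈ range k,
                ((∏ t ∈ Ico (m + 1 + j) (m + k + 1), g t) - ∏ t ∈ Ico (m + 1) (m + k + 1), g t)) := by
      intro k hk
      have hsat := flow_read_saturation hmono hL hb hlo hdom hh hf hL0 hg hgF hKL hRA hKA hKAtop he0 hea hεt hεrec
        (mem_Ico.mp hk).1 (mem_Ico.mp hk).2 IH (m := m)
      have hc0 : 0 ≤ L k * h (m + k) ^ 3 / 2 := by have := hL k; have := hpos (m + k); positivity
      have hin : ∑ j ∈ range k, ((∏ t ∈ Ico (m + 1 + j) (m + k + 1), g t) - ∏ t ∈ Ico (m + 1) (m + k + 1), g t) * e (m + 1 + j)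
          ≤ (∑ j ∈ range k, ((∏ t ∈ Ico (m + 1 + j) (m + k + 1), g t) - ∏ t ∈ Ico (m + 1) (m + k + 1), g t)) * e (m + 1) := by
        rw [sum_mul]
        refine sum_le_sum fun j hj => mul_le_mul_of_nonneg_left (hanti (show m + 1 ≤ m + 1 + j by omega)) ?_
        exact sub_nonneg.mpr (prod_window_ge_sub hg m k j (mem_range.mp hj).le)
      have := mul_le_mul_of_nonneg_left hin hc0
      nlinarith [he0 (m + 1)]
    rw [hreads]
    refine (sum_le_sum hk_le).trans ?_
    rw [← mul_sum]
    exact (mul_le_mul_of_nonneg_left (hcrit m) (he0 _)).trans (le_of_eq (mul_one _))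
  rw [hεrec m]
  linarith [hea m]

end Summit.QuantumFields.BalabanUV.Beta.EriceRemainderEnclosureHistoryAutonomyComparisonAgeCompositionUpwardChainSaturation
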